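import Literature.AlgebraicGeometry.Resolution.EtaleVanishingIdeal
import Literature.AlgebraicGeometry.Resolution.MaximalPoints
import Literature.AlgebraicGeometry.Resolution.StrictNormalCrossingsFlatDescent
import Literature.AlgebraicGeometry.Resolution.StrictNormalCrossingsDescent
import HarnessLib

/-!
# Branch strata of a strict normal crossings divisor with a marked part

Topic: `Literature/AlgebraicGeometry/Resolution`. Node F5 of the decomposition of
`DeJong1996NormalCrossingsBlowup` (de Jong 1996, 2.4; `NormalCrossingsStrictification.lean`): the
local and global structure of the strata "exactly `n` branches of `Z` not in `F` pass through
the point" of a strict normal crossings divisor `Z` with a marked strict normal crossings part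
`F ⊆ Z`, on a locally Noetherian scheme. Everything is PROVED.

* `exists_matched_rsop` — **matched coordinates**: at a point `t ∈ Z` where `Z` (and `F`, if
  `t ∈ F`) has strict normal crossings, there is a part `(f₁, …, f_k, g₁, …, g_n)` of a regular
  system of parameters of `𝒪_{X,t}` with `I(Z)_t = (∏ fⱼ · ∏ gᵢ)` and `I(F)_t = (∏ fⱼ)` (the
  branches of `F` are among those of `Z`: `∏ fⱼ' ∣ ∏ zᵢ` forces each prime `fⱼ'` to be a `zᵢ`);
  `branchOrder` of `Z` resp. `F` at `t` is then `k + n` resp. `k`.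
* Generisations and primes of `𝒪_{X,t}` (Stacks 01J7): `specializes_of_primeOfSpecializes_le`,
  `mem_of_stalkIdeal_vanishingIdeal_le`, `primeOfSpecializes_mem_minimalPrimes_of_mem_maxPoints`;
  `IsRsopPart.mem_minimalPrimes_span_prod_iff` — the minimal primes of `(∏ zᵢ)` are the `(zᵢ)`.
* `encard_maxPoints_not_mem_specializes` — **the number of maximal points of `Z` outside `F`
  specialising to `t` is `n`** (they correspond to the branches `(gᵢ)`:
  `exists_maxPoint_g`, `exists_primeOfSpecializes_eq_span_g`).
* `topStratum X Z F m = {t ∈ Z | branchOrder Z t = branchOrder F t + (m + 1)}`;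
  `topStratum_eq`, `isClosed_topStratum` — **the top stratum is closed** when
  `branchOrder Z ≤ branchOrder F + (m + 1)` on `Z` (it is the closed stratum of points under at
  least `m + 1` maximal points of `Z` outside `F`, `MaximalPoints.lean`);
  `stalkIdeal_vanishingIdeal_eq_vanishingIdeal_setOf` — the germ of the ideal of a closed set is
  the vanishing ideal of its trace on `Spec 𝒪_{X,t}`; `setOf_fromSpecStalk_mem_topStratum`,
  `stalkIdeal_vanishingIdeal_topStratum` — **the ideal of the top stratum at `t ∈ C` is
  `(g₁, …, g_{m+1})`** (regular centre of codimension `m + 1` in normal crossings position).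

## Sources

* A. J. de Jong, *Smoothness, semi-stability and alterations*, Publ. Math. IHÉS 83 (1996), 2.4.
* The Stacks Project, Tags 0BI9, 0BIA, 01J7.
-/

noncomputable section

open CategoryTheory AlgebraicGeometry TopologicalSpace Topology IsLocalRing

universe u

namespace Literature.AlgebraicGeometry.Resolution

open Scheme.IdealSheafData

/-! ## Matched coordinates for `F ⊆ Z` -/

section Matched

variable {R : Type u} [CommRing R] [IsLocalRing R]

/-- **Matching a marked sub-divisor to branches** (local algebra): if `z : Fin r → R` is part
of a regular system of parameters and `f' : Fin k → R` is part of one with `∏ f'ⱼ ∣ ∏ zᵢ`,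
then after reindexing `z = (f, g)` with each `fⱼ` associated to `f'ⱼ`:
`(∏ zᵢ) = (∏ fⱼ · ∏ gᵢ)` and `(∏ f'ⱼ) = (∏ fⱼ)`. [folklore] -/
theorem IsRsopPart.exists_append_of_prod_dvd_prod {r k : ℕ} {z : Fin r → R} (hz : IsRsopPart z)
    {f' : Fin k → R} (hf' : IsRsopPart f') (hdvd : ∏ j, f' j ∣ ∏ i, z i) :
    ∃ (n : ℕ) (f : Fin k → R) (g : Fin n → R), k + n = r ∧ IsRsopPart (Fin.append f g) ∧
      Ideal.span {∏ i, z i} = Ideal.span {(∏ j, f j) * ∏ i, g i} ∧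
      Ideal.span {∏ j, f' j} = Ideal.span {∏ j, f j} := by
  classical
  haveI := hz.isRegularLocalRing
  haveI := isDomain_of_isRegularLocalRing R
  -- each `f'ⱼ` is associated to some `z_{σ j}`
  have hσ : ∀ j, ∃ i, Associated (f' j) (z i) := fun j =>
    hz.exists_associated_of_prime_dvd_prod (hf'.prime j)
      ((Finset.dvd_prod_of_mem f' (Finset.mem_univ j)).trans hdvd)
  choose σ hσ using hσ
  have hσinj : Function.Injective σ := by
    intro j j' h
    by_contra hne
    exact hf'.not_associated hne ((hσ j).trans (h ▸ (hσ j').symm))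
  -- enumerate the complement of the range of `σ`
  set T : Finset (Fin r) := Finset.univ \ Finset.univ.image σ with hT
  have hk : k ≤ r := by simpa using Fintype.card_le_of_injective σ hσinj
  have hcard : T.card = r - k := by
    rw [hT, Finset.card_sdiff_of_subset (Finset.subset_univ _), Finset.card_univ, Fintype.card_fin,
      Finset.card_image_of_injective _ hσinj, Finset.card_univ, Fintype.card_fin]
  let τ : Fin (r - k) → Fin r := fun i => T.orderEmbOfFin hcard i
  have hτmem : ∀ i, τ i ∈ T := fun i => by
    have := Finset.orderEmbOfFin_mem T hcard i
    exact this
  have hτinj : Function.Injective τ := fun i i' h => (T.orderEmbOfFin hcard).injective h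
  -- the combined reindexing `Fin (k + (r - k)) → Fin r` is injective (indeed bijective)
  let ρ : Fin (k + (r - k)) → Fin r := Fin.append (σ) τ
  have hρinj : Function.Injective ρ := by
    intro a b hab
    induction a using Fin.addCases with
    | left a =>
      induction b using Fin.addCases with
      | left b =>
        simp only [ρ, Fin.append_left] at hab
        rw [hσinj hab]
      | right b =>
        simp only [ρ, Fin.append_left, Fin.append_right] at hab
        have h1 : τ b ∈ T := hτmem b
        rw [hT, Finset.mem_sdiff] at h1
        exact absurd (Finset.mem_image.mpr ⟨a, Finset.mem_univ _, hab⟩) h1.2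
    | right a =>
      induction b using Fin.addCases with
      | left b =>
        simp only [ρ, Fin.append_left, Fin.append_right] at hab
        have h1 : τ a ∈ T := hτmem a
        rw [hT, Finset.mem_sdiff] at h1
        exact absurd (Finset.mem_image.mpr ⟨b, Finset.mem_univ _, hab.symm⟩) h1.2
      | right b =>
        simp only [ρ, Fin.append_right] at hab
        rw [hτinj hab]
  have hρbij : Function.Bijective ρ := by
    refine (Fintype.bijective_iff_injective_and_card ρ).mpr ⟨hρinj, ?_⟩
    simp only [Fintype.card_fin]
    omega
  let e : Fin (k + (r - k)) ≃ Fin r := Equiv.ofBijective ρ hρbij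
  refine ⟨r - k, z ∘ σ, z ∘ τ, by omega, ?_, ?_, ?_⟩
  · -- `(z ∘ σ, z ∘ τ) = z ∘ ρ`
    have : Fin.append (z ∘ σ) (z ∘ τ) = z ∘ ρ := by
      ext a
      induction a using Fin.addCases with
      | left a => simp [ρ]
      | right a => simp [ρ]
    rw [this]
    exact hz.comp ρ hρinj
  · -- `∏ z = ∏ (z ∘ σ) * ∏ (z ∘ τ)` by reindexing along the bijection `ρ`
    congr 2
    have h1 : ∏ i, z i = ∏ a, z (ρ a) :=
      (Fintype.prod_equiv e (fun a => z (ρ a)) z fun a => rfl).symm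
    rw [h1, Fin.prod_univ_add]
    simp [ρ]
  · exact Ideal.span_singleton_eq_span_singleton.mpr
      (Associated.prod (s := Finset.univ) _ _ fun j _ => hσ j) |>.trans (by rfl)

end Matched

section MatchedScheme

variable {X : Scheme.{u}} {Z F : Set X} {t : X}

/-- **Matched coordinates at a point of a strict normal crossings divisor with a marked strict
normal crossings part.** Let `F ⊆ Z ⊆ X` with `F` closed, `t ∈ Z`, `Z` with strict normal
crossings at `t`, and `F` with strict normal crossings at `t` if `t ∈ F`. Then there is a part
`(f₁, …, f_k, g₁, …, g_n)` of a regular system of parameters of `𝒪_{X,t}` (`k + n ≥ 1`) with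
`I(Z)_t = (∏ fⱼ · ∏ gᵢ)` and `I(F)_t = (∏ fⱼ)` (`= 𝒪_{X,t}`, `k = 0`, when `t ∉ F`).
[cite: StacksProject, Tag 0BIA] -/
theorem exists_matched_rsop (hFZ : F ⊆ Z) (hF : IsClosed F) (hZt : IsStrictNormalCrossingsAt X Z t)
    (hFt : t ∈ F → IsStrictNormalCrossingsAt X F t) :
    ∃ (k n : ℕ) (f : Fin k → X.presheaf.stalk t) (g : Fin n → X.presheaf.stalk t),
      1 ≤ k + n ∧ IsRsopPart (Fin.append f g) ∧
      stalkIdeal (vanishingIdeal ⟨closure Z, isClosed_closure⟩) t =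
        Ideal.span {(∏ j, f j) * ∏ i, g i} ∧
      stalkIdeal (vanishingIdeal ⟨closure F, isClosed_closure⟩) t = Ideal.span {∏ j, f j} := by
  obtain ⟨r, z, hr, hz, hIZ⟩ := (isSNCIdeal_iff_exists_isRsopPart _).mp hZt
  by_cases ht : t ∈ F
  · obtain ⟨k, f', hk, hf', hIF⟩ := (isSNCIdeal_iff_exists_isRsopPart _).mp (hFt ht)
    -- `I(Z)_t ≤ I(F)_t`, i.e. `∏ f' ∣ ∏ z`
    have hle : stalkIdeal (vanishingIdeal ⟨closure Z, isClosed_closure⟩) t ≤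
        stalkIdeal (vanishingIdeal ⟨closure F, isClosed_closure⟩) t :=
      stalkIdeal_mono (vanishingIdeal_antimono (show ((⟨closure F, isClosed_closure⟩ : Closeds X) :
        Set X) ⊆ (⟨closure Z, isClosed_closure⟩ : Closeds X) from closure_mono hFZ)) t
    rw [hIZ, hIF, Ideal.span_singleton_le_span_singleton] at hle
    obtain ⟨n, f, g, hkn, hfg, h1, h2⟩ := hz.exists_append_of_prod_dvd_prod hf' hle
    exact ⟨k, n, f, g, by omega, hfg, hIZ.trans h1, hIF.trans h2⟩
  · -- `t ∉ F`: `I(F)_t = ⊤`, take `k = 0`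
    refine ⟨0, r, Fin.elim0, z, by simpa using hr, ?_, ?_, ?_⟩
    · have : Fin.append Fin.elim0 z = z ∘ Fin.cast (Nat.zero_add r) := by
        ext i
        simp [Fin.append, Fin.addCases]
      rw [this]
      exact hz.comp _ (Fin.cast_injective _)
    · rw [hIZ]
      simp
    · rw [Finset.univ_eq_empty, Finset.prod_empty, Ideal.span_singleton_one]
      apply stalkIdeal_eq_top_of_not_mem_support
      rw [← SetLike.mem_coe, coe_support_vanishingIdeal]
      change t ∉ closure F
      rwa [hF.closure_eq]

/-- With matched coordinates, the branch orders are `k + n` for `Z` and `k` for `F`.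
[cite: DeJong1996, 2.4, p. 55] -/
theorem branchOrder_eq_of_matched {k n : ℕ} {f : Fin k → X.presheaf.stalk t}
    {g : Fin n → X.presheaf.stalk t} (hfg : IsRsopPart (Fin.append f g))
    (hIZ : stalkIdeal (vanishingIdeal ⟨closure Z, isClosed_closure⟩) t =
      Ideal.span {(∏ j, f j) * ∏ i, g i})
    (hIF : stalkIdeal (vanishingIdeal ⟨closure F, isClosed_closure⟩) t = Ideal.span {∏ j, f j}) :
    branchOrder X Z t = (k + n : ℕ) ∧ branchOrder X F t = k := by
  constructor
  · apply branchOrder_eq_of_isRsopPart hfg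
    rw [hIZ, Fin.prod_univ_add]
    simp
  · exact branchOrder_eq_of_isRsopPart hfg.append_left hIF

end MatchedScheme

/-! ## Generisations of a point and primes of its local ring -/

section Generization

variable {X : Scheme.{u}} {t : X}

/-- Inclusion of the primes `𝔭_{η'} ≤ 𝔭_η` of two generisations of `t` means `η' ⤳ η`
(`Spec 𝒪_{X,t} → X` is a homeomorphism onto the generisations of `t`, Stacks 01J7).
[cite: StacksProject, Tag 01J7] -/
theorem specializes_of_primeOfSpecializes_le {η η' : X} (h : η ⤳ t) (h' : η' ⤳ t)
    (hle : primeOfSpecializes h' ≤ primeOfSpecializes h) : η' ⤳ η := by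
  let q : Spec (X.presheaf.stalk t) := ⟨primeOfSpecializes h, inferInstance⟩
  let q' : Spec (X.presheaf.stalk t) := ⟨primeOfSpecializes h', inferInstance⟩
  have hqq : q' ⤳ q := (PrimeSpectrum.le_iff_specializes q' q).mp hle
  have := hqq.map (X.fromSpecStalk t).continuous
  rwa [Literature.AlgebraicGeometry.Motives.fromSpecStalk_comap_maximalIdeal h,
    Literature.AlgebraicGeometry.Motives.fromSpecStalk_comap_maximalIdeal h'] at this

/-- Conversely `η' ⤳ η` gives `𝔭_{η'} ≤ 𝔭_η`. [cite: StacksProject, Tag 01J7] -/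
theorem primeOfSpecializes_le_of_specializes {η η' : X} (h : η ⤳ t) (h' : η' ⤳ t)
    (hs : η' ⤳ η) : primeOfSpecializes h' ≤ primeOfSpecializes h := by
  have := primeOfSpecializes_mono h hs
  exact this

/-- **A generisation `η` of `t` lies in the closed set `Z` as soon as `I(Z)_t ≤ 𝔭_η`**
(a section on an affine neighbourhood vanishing on `Z` but not at `η` would contradict this).
[cite: StacksProject, Tag 01J7] -/
theorem mem_of_stalkIdeal_vanishingIdeal_le {Z : Closeds X} {η : X} (h : η ⤳ t)
    (hle : stalkIdeal (vanishingIdeal Z) t ≤ primeOfSpecializes h) : η ∈ Z := by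
  obtain ⟨U, hU, htU, -⟩ :=
    exists_isAffineOpen_mem_and_subset (X := X) (x := t) (U := ⊤) (Opens.mem_top _)
  have hηU : η ∈ U := h.mem_open U.isOpen htU
  by_contra hηZ
  have hcl : IsClosed (hU.fromSpec ⁻¹' (Z : Set X)) := Z.isClosed.preimage hU.fromSpec.continuous
  have hq : hU.primeIdealOf ⟨η, hηU⟩ ∉
      PrimeSpectrum.zeroLocus (PrimeSpectrum.vanishingIdeal (hU.fromSpec ⁻¹' (Z : Set X))) := by
    intro hmem
    rw [PrimeSpectrum.zeroLocus_vanishingIdeal_eq_closure] at hmem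
    have hmem' := hcl.closure_subset hmem
    apply hηZ
    have : hU.fromSpec (hU.primeIdealOf ⟨η, hηU⟩) ∈ (Z : Set X) := hmem'
    rwa [IsAffineOpen.fromSpec_primeIdealOf] at this
  rw [PrimeSpectrum.mem_zeroLocus, Set.not_subset] at hq
  obtain ⟨s, hs, hsq⟩ := hq
  have h1 : (X.presheaf.germ U t htU).hom s ∈ stalkIdeal (vanishingIdeal Z) t := by
    rw [stalkIdeal_eq_map_germ _ ⟨U, hU⟩ htU]
    exact Ideal.mem_map_of_mem _ (by rwa [vanishingIdeal_ideal])
  have h2 : (X.presheaf.germ U t htU).hom s ∈ primeOfSpecializes h := hle h1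
  rw [← Ideal.mem_comap, comap_germ_primeOfSpecializes h ⟨U, hU⟩ htU] at h2
  exact hsq h2

/-- `η ∈ Z ↔ I(Z)_t ≤ 𝔭_η` for a generisation `η` of `t` and a closed `Z`.
[cite: StacksProject, Tag 01J7] -/
theorem mem_iff_stalkIdeal_vanishingIdeal_le {Z : Closeds X} {η : X} (h : η ⤳ t) :
    η ∈ Z ↔ stalkIdeal (vanishingIdeal Z) t ≤ primeOfSpecializes h :=
  ⟨stalkIdeal_vanishingIdeal_le h, mem_of_stalkIdeal_vanishingIdeal_le h⟩

/-- **Maximal points of `Z` through `t` give minimal primes of `I(Z)_t`.**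
[cite: StacksProject, Tag 01J7] -/
theorem primeOfSpecializes_mem_minimalPrimes_of_mem_maxPoints {Z : Closeds X} {η : X}
    (hη : η ∈ maxPoints (Z : Set X)) (h : η ⤳ t) :
    primeOfSpecializes h ∈ (stalkIdeal (vanishingIdeal Z) t).minimalPrimes := by
  have hle : stalkIdeal (vanishingIdeal Z) t ≤ primeOfSpecializes h :=
    stalkIdeal_vanishingIdeal_le h hη.1
  obtain ⟨P, hP, hPle⟩ := Ideal.exists_minimalPrimes_le hle
  obtain ⟨η', h', hη'Z, -, rfl⟩ := exists_isMax_of_mem_minimalPrimes hP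
  have hs : η' ⤳ η := specializes_of_primeOfSpecializes_le h h' hPle
  have : η' = η := hη.2 η' hη'Z hs
  subst this
  exact hP

end Generization

/-! ## Minimal primes of the product of a part of a regular system of parameters -/

section MinimalPrimes

variable {R : Type u} [CommRing R] [IsLocalRing R] {n : ℕ} {z : Fin n → R}

/-- **The minimal primes of `(∏ zᵢ)` are exactly the `(zᵢ)`** for a part `z` of a regular system
of parameters. [cite: Matsumura1987, Thm. 14.2] -/
theorem IsRsopPart.mem_minimalPrimes_span_prod_iff (hz : IsRsopPart z) (P : Ideal R) :
    P ∈ (Ideal.span {∏ i, z i}).minimalPrimes ↔ ∃ i, P = Ideal.span {z i} := by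
  haveI := hz.isRegularLocalRing
  obtain ⟨e, y, hdim, hspan⟩ := hz.2
  constructor
  · intro hP
    haveI := hP.1.1
    have hmem : ∏ i, z i ∈ P := hP.1.2 (Ideal.mem_span_singleton_self _)
    obtain ⟨i, -, hi⟩ := Ideal.IsPrime.prod_mem_iff.mp hmem
    refine ⟨i, ?_⟩
    have hmin := span_singleton_mem_minimalPrimes_of_rsop z y hdim hspan i
    have hle : Ideal.span {z i} ≤ P := (Ideal.span_singleton_le_iff_mem _).mpr hi
    exact le_antisymm (hP.2 hmin.1 hle) hle
  · rintro ⟨i, rfl⟩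
    exact span_singleton_mem_minimalPrimes_of_rsop z y hdim hspan i

end MinimalPrimes

/-! ## Counting the maximal points outside `F` through a point -/

section Count

variable {X : Scheme.{u}} {Z F : Set X} (hZ : IsClosed Z) (hF : IsClosed F) {t : X}
  {k n : ℕ} {f : Fin k → X.presheaf.stalk t} {g : Fin n → X.presheaf.stalk t}
  (hfg : IsRsopPart (Fin.append f g))
  (hIZ : stalkIdeal (vanishingIdeal ⟨Z, hZ⟩) t = Ideal.span {(∏ j, f j) * ∏ i, g i})
  (hIF : stalkIdeal (vanishingIdeal ⟨closure F, isClosed_closure⟩) t = Ideal.span {∏ j, f j})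

include hIZ in
/-- With matched coordinates `(f, g)` at `t`: `I(Z)_t = (∏ (f, g))`. [folklore] -/
theorem stalkIdeal_eq_span_prod_append :
    stalkIdeal (vanishingIdeal ⟨Z, hZ⟩) t = Ideal.span {∏ a, Fin.append f g a} := by
  rw [hIZ, Fin.prod_univ_add]
  simp

include hfg hIF hF in
/-- With matched coordinates: the branch `(gᵢ)` is not a branch of `F`, i.e. `I(F)_t ≰ (gᵢ)`.
[folklore] -/
theorem not_stalkIdeal_le_span_g (i : Fin n) :
    ¬ stalkIdeal (vanishingIdeal ⟨F, hF⟩) t ≤ Ideal.span {g i} := by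
  have hcl : (⟨closure F, isClosed_closure⟩ : Closeds X) = ⟨F, hF⟩ := Closeds.ext hF.closure_eq
  rw [← hcl, hIF, Ideal.span_singleton_le_span_singleton]
  intro hdvd
  haveI := hfg.isRegularLocalRing
  haveI := isDomain_of_isRegularLocalRing (X.presheaf.stalk t)
  -- `gᵢ ∣ ∏ f` forces `gᵢ ~ fⱼ = (f,g)_{castAdd j}`, contradicting non-association
  obtain ⟨j, -, hj⟩ := ((hfg.append_right.prime i).dvd_finsetProd_iff _).mp hdvd
  have hassoc : Associated (Fin.append f g (Fin.natAdd k i)) (Fin.append f g (Fin.castAdd n j)) := by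
    rw [Fin.append_right, Fin.append_left]
    exact (hfg.append_right.prime i).irreducible.associated_of_dvd
      (hfg.append_left.prime j).irreducible hj
  refine hfg.not_associated (i := Fin.natAdd k i) (j := Fin.castAdd n j) ?_ hassoc
  intro h
  have := congrArg Fin.val h
  simp at this
  omega

include hfg hIF hF in
/-- With matched coordinates: a branch `((f,g)_a)` containing `I(F)_t` is an `f`-branch.
[folklore] -/
theorem exists_eq_castAdd_of_stalkIdeal_le {a : Fin (k + n)}
    (hle : stalkIdeal (vanishingIdeal ⟨F, hF⟩) t ≤ Ideal.span {Fin.append f g a}) :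
    ∃ j : Fin k, a = Fin.castAdd n j := by
  induction a using Fin.addCases with
  | left j => exact ⟨j, rfl⟩
  | right i =>
    rw [Fin.append_right] at hle
    exact absurd hle (not_stalkIdeal_le_span_g hF hfg hIF i)

include hfg hIZ in
/-- With matched coordinates: the maximal point of `Z` through `t` on the branch `(gᵢ)`.
[cite: StacksProject, Tag 01J7] -/
theorem exists_maxPoint_g (i : Fin n) :
    ∃ (η : X) (h : η ⤳ t), η ∈ maxPoints Z ∧ primeOfSpecializes h = Ideal.span {g i} := by
  have hmin : Ideal.span {g i} ∈ (stalkIdeal (vanishingIdeal ⟨Z, hZ⟩) t).minimalPrimes := by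
    rw [stalkIdeal_eq_span_prod_append hZ hIZ, hfg.mem_minimalPrimes_span_prod_iff]
    exact ⟨Fin.natAdd k i, by rw [Fin.append_right]⟩
  obtain ⟨η, h, hηZ, hmax, hP⟩ := exists_isMax_of_mem_minimalPrimes hmin
  exact ⟨η, h, ⟨hηZ, hmax⟩, hP.symm⟩

include hfg hIF hF in
/-- With matched coordinates: a generisation of `t` whose prime is a branch `(gᵢ)` does not lie
on `F`. [folklore] -/
theorem not_mem_of_primeOfSpecializes_eq_span_g {η : X} (h : η ⤳ t) {i : Fin n}
    (hP : primeOfSpecializes h = Ideal.span {g i}) : η ∉ F := by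
  intro hηF
  have := (mem_iff_stalkIdeal_vanishingIdeal_le (Z := ⟨F, hF⟩) h).mp hηF
  rw [hP] at this
  exact not_stalkIdeal_le_span_g hF hfg hIF i this

include hfg hIZ hIF hF in
/-- With matched coordinates: **a maximal point of `Z` outside `F` specialising to `t` has prime
one of the branches `(gᵢ)`**. [cite: StacksProject, Tag 01J7] -/
theorem exists_primeOfSpecializes_eq_span_g {y : X} (hymax : y ∈ maxPoints Z) (hyF : y ∉ F)
    (hyt : y ⤳ t) : ∃ i : Fin n, primeOfSpecializes hyt = Ideal.span {g i} := by
  have hmin := primeOfSpecializes_mem_minimalPrimes_of_mem_maxPoints (Z := ⟨Z, hZ⟩) hymax hyt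
  rw [stalkIdeal_eq_span_prod_append hZ hIZ, hfg.mem_minimalPrimes_span_prod_iff] at hmin
  obtain ⟨a, ha⟩ := hmin
  induction a using Fin.addCases with
  | left j =>
    -- an `f`-branch: then `y ∈ F`, contradiction
    exfalso
    apply hyF
    apply mem_of_stalkIdeal_vanishingIdeal_le (Z := ⟨F, hF⟩) hyt
    have hcl : (⟨closure F, isClosed_closure⟩ : Closeds X) = ⟨F, hF⟩ :=
      Closeds.ext hF.closure_eq
    rw [ha, Fin.append_left, ← hcl, hIF, Ideal.span_singleton_le_span_singleton]
    exact Finset.dvd_prod_of_mem f (Finset.mem_univ j)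
  | right i =>
    refine ⟨i, ?_⟩
    rw [Fin.append_right] at ha
    exact ha

include hfg hIZ hIF hF in
/-- **The maximal points of `Z` outside `F` specialising to `t` are in bijection with the
branches `(gᵢ)`**: their number is `n`. [cite: StacksProject, Tag 0BIA] -/
theorem encard_maxPoints_not_mem_specializes :
    {η | (η ∈ maxPoints Z ∧ η ∉ F) ∧ η ⤳ t}.encard = n := by
  classical
  haveI := hfg.isRegularLocalRing
  haveI := isDomain_of_isRegularLocalRing (X.presheaf.stalk t)
  choose η hη hηmax hηP using exists_maxPoint_g hZ hfg hIZ
  -- the map `i ↦ ηᵢ` is injective with image the set in question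
  have hinj : Function.Injective η := by
    intro i i' h
    have hP : Ideal.span {g i} = Ideal.span {g i'} := by rw [← hηP i, ← hηP i']; congr 1
    by_contra hne
    refine hfg.append_right.not_associated hne ?_
    exact Ideal.span_singleton_eq_span_singleton.mp hP
  have hrange : Set.range η = {η | (η ∈ maxPoints Z ∧ η ∉ F) ∧ η ⤳ t} := by
    ext y
    simp only [Set.mem_range, Set.mem_setOf_eq]
    constructor
    · rintro ⟨i, rfl⟩
      exact ⟨⟨hηmax i, not_mem_of_primeOfSpecializes_eq_span_g hF hfg hIF (hη i) (hηP i)⟩, hη i⟩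
    · rintro ⟨⟨hymax, hyF⟩, hyt⟩
      obtain ⟨i, hi⟩ := exists_primeOfSpecializes_eq_span_g hZ hF hfg hIZ hIF hymax hyF hyt
      refine ⟨i, ?_⟩
      have : primeOfSpecializes (hη i) = primeOfSpecializes hyt := by rw [hηP i, hi]
      exact Literature.AlgebraicGeometry.Motives.eq_of_comap_maximalIdeal_eq _ _ this
  rw [← hrange, ← Set.image_univ, hinj.encard_image, Set.encard_univ,
    ENat.card_eq_coe_fintype_card, Fintype.card_fin]

end Count

/-! ## The top stratum: closedness and its ideal -/

section TopStratum

variable {X : Scheme.{u}} {Z F : Set X}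

/-- The **top stratum** of unmarked branches: the points of `Z` lying on exactly `m + 1`
branches of `Z` that are not branches of `F` (in terms of `branchOrder`). [folklore] -/
def topStratum (X : Scheme.{u}) (Z F : Set X) (m : ℕ) : Set X :=
  {t | t ∈ Z ∧ branchOrder X Z t = branchOrder X F t + (m + 1 : ℕ)}

/-- Unfolding lemma for `topStratum`. [folklore] -/
theorem mem_topStratum_iff {m : ℕ} {t : X} :
    t ∈ topStratum X Z F m ↔ t ∈ Z ∧ branchOrder X Z t = branchOrder X F t + (m + 1 : ℕ) :=
  Iff.rfl

/-- The top stratum lies in `Z`. [folklore] -/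
theorem topStratum_subset (m : ℕ) : topStratum X Z F m ⊆ Z := fun _ h => h.1

variable (hZ : IsStrictNormalCrossingsDivisor X Z) (hF : IsStrictNormalCrossingsDivisor X F)
  (hFZ : F ⊆ Z) {m : ℕ} (hb : ∀ t ∈ Z, branchOrder X Z t ≤ branchOrder X F t + (m + 1 : ℕ))

include hZ hF hFZ hb in
/-- **The top stratum is the stratum of points under at least `m + 1` maximal points of `Z`
outside `F`.** [cite: StacksProject, Tag 0BIA] -/
theorem topStratum_eq :
    topStratum X Z F m =
      Z ∩ {t | ((m + 1 : ℕ) : ℕ∞) ≤ {η ∈ {η ∈ maxPoints Z | η ∉ F} | η ⤳ t}.encard} := by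
  ext t
  simp only [mem_topStratum_iff, Set.mem_inter_iff, Set.mem_setOf_eq]
  refine and_congr_right fun ht => ?_
  -- matched coordinates at `t`
  obtain ⟨k, n, f, g, -, hfg, hIZ, hIF⟩ := exists_matched_rsop hFZ hF.isClosed
    (hZ.isStrictNormalCrossingsAt ht) fun htF => hF.isStrictNormalCrossingsAt htF
  have hclZ : (⟨closure Z, isClosed_closure⟩ : Closeds X) = ⟨Z, hZ.isClosed⟩ :=
    Closeds.ext hZ.isClosed.closure_eq
  obtain ⟨hbZ, hbF⟩ := branchOrder_eq_of_matched hfg hIZ hIF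
  rw [hclZ] at hIZ
  rw [encard_maxPoints_not_mem_specializes hZ.isClosed hF.isClosed hfg hIZ hIF, hbZ, hbF]
  have hbt := hb t ht
  rw [hbZ, hbF] at hbt
  have hbt' : n ≤ m + 1 := by
    have : ((k + n : ℕ) : ℕ∞) ≤ ((k + (m + 1) : ℕ) : ℕ∞) := by push_cast at hbt ⊢; exact hbt
    have := ENat.coe_le_coe.mp this
    omega
  constructor
  · intro h
    have h' : ((k + n : ℕ) : ℕ∞) = ((k + (m + 1) : ℕ) : ℕ∞) := by push_cast at h ⊢; exact h
    have := ENat.coe_inj.mp h'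
    exact_mod_cast (by omega : m + 1 ≤ n)
  · intro h
    have h' : m + 1 ≤ n := by exact_mod_cast h
    have : n = m + 1 := le_antisymm hbt' h'
    subst this
    push_cast
    ring

include hZ hF hFZ hb in
/-- **The top stratum is closed.** [cite: DeJong1996, 2.4, p. 55] -/
theorem isClosed_topStratum [IsLocallyNoetherian X] : IsClosed (topStratum X Z F m) := by
  rw [topStratum_eq hZ hF hFZ hb]
  exact hZ.isClosed.inter (isClosed_setOf_le_encard_specializes hZ.isClosed
    (fun η hη => hη.1) (m + 1))

end TopStratum

/-! ## The germ of the ideal of a closed set -/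

section Germ

variable {X : Scheme.{u}} {t : X}

/-- Points of `Spec 𝒪_{X,t}` specialise to `t`. [cite: StacksProject, Tag 01J7] -/
theorem fromSpecStalk_specializes (q : Spec (X.presheaf.stalk t)) : X.fromSpecStalk t q ⤳ t := by
  have : X.fromSpecStalk t q ∈ Set.range (X.fromSpecStalk t) := ⟨q, rfl⟩
  rwa [Scheme.range_fromSpecStalk] at this

/-- The prime `𝔭_y` of the generisation `y` defined by `q ∈ Spec 𝒪_{X,t}` is `q`.
[cite: StacksProject, Tag 01J7] -/
theorem primeOfSpecializes_fromSpecStalk (q : Spec (X.presheaf.stalk t)) :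
    primeOfSpecializes (fromSpecStalk_specializes q) = q.asIdeal := by
  have h := Literature.AlgebraicGeometry.Motives.fromSpecStalk_comap_maximalIdeal
    (fromSpecStalk_specializes q)
  have hinj := (X.fromSpecStalk t).isEmbedding.injective h
  exact congrArg PrimeSpectrum.asIdeal hinj

/-- **The germ of the ideal of a closed set is the vanishing ideal of its trace on
`Spec 𝒪_{X,t}`**: `I(C)_t = {a ∈ 𝒪_{X,t} | a ∈ 𝔮 for all 𝔮 ∈ Spec 𝒪_{X,t} mapping into C}`.
(On an affine `U ∋ t`: `C ∩ U = V(𝔞)`, `𝔞 = I_C(U)` radical, the trace is `V(𝔞 𝒪_{X,t})` and its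
vanishing ideal is `√(𝔞 𝒪_{X,t}) = 𝔞 𝒪_{X,t} = I(C)_t`.) [cite: StacksProject, Tag 01J7] -/
theorem stalkIdeal_vanishingIdeal_eq_vanishingIdeal_setOf (C : Closeds X) (t : X) :
    stalkIdeal (vanishingIdeal C) t =
      PrimeSpectrum.vanishingIdeal {q : PrimeSpectrum (X.presheaf.stalk t) |
        X.fromSpecStalk t q ∈ (C : Set X)} := by
  obtain ⟨U, hU, htU, -⟩ :=
    exists_isAffineOpen_mem_and_subset (X := X) (x := t) (U := ⊤) (Opens.mem_top _)
  set 𝔞 : Ideal Γ(X, U) := (vanishingIdeal C).ideal ⟨U, hU⟩ with h𝔞def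
  have h𝔞 : 𝔞 = PrimeSpectrum.vanishingIdeal (hU.fromSpec ⁻¹' (C : Set X)) := by
    rw [h𝔞def, vanishingIdeal_ideal]
  have hcl : IsClosed (hU.fromSpec ⁻¹' (C : Set X)) := C.isClosed.preimage hU.fromSpec.continuous
  -- the trace of `C` on `Spec 𝒪_{X,t}` is `V(𝔞 𝒪_{X,t})`
  have hpre : ∀ q : PrimeSpectrum (X.presheaf.stalk t),
      X.fromSpecStalk t q ∈ (C : Set X) ↔ 𝔞.map (X.presheaf.germ U t htU).hom ≤ q.asIdeal := by
    intro q
    rw [fromSpecStalk_apply hU htU q, Ideal.map_le_iff_le_comap]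
    constructor
    · intro hq
      have hmem : PrimeSpectrum.comap (X.presheaf.germ U t htU).hom q ∈
          PrimeSpectrum.zeroLocus (𝔞 : Set Γ(X, U)) := by
        rw [h𝔞, PrimeSpectrum.zeroLocus_vanishingIdeal_eq_closure]
        exact subset_closure hq
      exact (PrimeSpectrum.mem_zeroLocus _ _).mp hmem
    · intro hq
      have hmem : PrimeSpectrum.comap (X.presheaf.germ U t htU).hom q ∈
          PrimeSpectrum.zeroLocus (𝔞 : Set Γ(X, U)) := (PrimeSpectrum.mem_zeroLocus _ _).mpr hq
      rw [h𝔞, PrimeSpectrum.zeroLocus_vanishingIdeal_eq_closure] at hmem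
      exact hcl.closure_subset hmem
  have hset : {q : PrimeSpectrum (X.presheaf.stalk t) | X.fromSpecStalk t q ∈ (C : Set X)} =
      PrimeSpectrum.zeroLocus ((𝔞.map (X.presheaf.germ U t htU).hom : Ideal _) : Set _) := by
    ext q
    rw [Set.mem_setOf_eq, hpre q, PrimeSpectrum.mem_zeroLocus, SetLike.coe_subset_coe]
  have hrad : (stalkIdeal (vanishingIdeal C) t).IsRadical := isRadical_stalkIdeal_vanishingIdeal C t
  rw [stalkIdeal_eq_map_germ _ ⟨U, hU⟩ htU] at hrad ⊢
  rw [hset, PrimeSpectrum.vanishingIdeal_zeroLocus_eq_radical]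
  exact hrad.radical.symm

end Germ

/-! ## The ideal of the top stratum at its points -/

section TopStratumIdeal

variable {X : Scheme.{u}} [IsLocallyNoetherian X] {Z F : Set X}
  (hZ : IsStrictNormalCrossingsDivisor X Z) (hF : IsStrictNormalCrossingsDivisor X F)
  (hFZ : F ⊆ Z) {m : ℕ} (hb : ∀ t ∈ Z, branchOrder X Z t ≤ branchOrder X F t + (m + 1 : ℕ))
  {t : X} {k n : ℕ} {f : Fin k → X.presheaf.stalk t} {g : Fin n → X.presheaf.stalk t}
  (hfg : IsRsopPart (Fin.append f g))
  (hIZ : stalkIdeal (vanishingIdeal ⟨Z, hZ.isClosed⟩) t = Ideal.span {(∏ j, f j) * ∏ i, g i})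
  (hIF : stalkIdeal (vanishingIdeal ⟨closure F, isClosed_closure⟩) t = Ideal.span {∏ j, f j})

omit [IsLocallyNoetherian X] in
include hfg hIZ hIF in
/-- With matched coordinates at a point of the top stratum, the number of unmarked branches is
`n = m + 1`. [folklore] -/
theorem eq_of_mem_topStratum_of_matched (ht : t ∈ topStratum X Z F m) : n = m + 1 := by
  have hclZ : (⟨closure Z, isClosed_closure⟩ : Closeds X) = ⟨Z, hZ.isClosed⟩ :=
    Closeds.ext hZ.isClosed.closure_eq
  have hIZ' : stalkIdeal (vanishingIdeal ⟨closure Z, isClosed_closure⟩) t =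
      Ideal.span {(∏ j, f j) * ∏ i, g i} := by rw [hclZ]; exact hIZ
  obtain ⟨hbZ, hbF⟩ := branchOrder_eq_of_matched hfg hIZ' hIF
  have h := ht.2
  rw [hbZ, hbF] at h
  have h' : ((k + n : ℕ) : ℕ∞) = ((k + (m + 1) : ℕ) : ℕ∞) := by push_cast at h ⊢; exact h
  have := ENat.coe_inj.mp h'
  omega

omit [IsLocallyNoetherian X] in
include hZ hF hFZ hb hfg hIZ hIF in
/-- **The trace of the top stratum on `Spec 𝒪_{X,t}` is `V(g₁, …, g_n)`** for `t` in the top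
stratum with matched coordinates `(f, g)`: a generisation `y` of `t` lies in the top stratum iff
all `m + 1 = n` maximal points of `Z` outside `F` through `t` (the branches `(gᵢ)`) pass
through `y`, iff every `gᵢ` lies in the prime of `y`. [cite: StacksProject, Tag 0BIA] -/
theorem setOf_fromSpecStalk_mem_topStratum (ht : t ∈ topStratum X Z F m) :
    {q : PrimeSpectrum (X.presheaf.stalk t) | X.fromSpecStalk t q ∈ topStratum X Z F m} =
      PrimeSpectrum.zeroLocus (Set.range g) := by
  classical
  have hn : n = m + 1 := eq_of_mem_topStratum_of_matched hZ hfg hIZ hIF ht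
  subst hn
  haveI := hfg.isRegularLocalRing
  haveI := isDomain_of_isRegularLocalRing (X.presheaf.stalk t)
  choose η hη hηmax hηP using exists_maxPoint_g hZ.isClosed hfg hIZ
  have hinj : Function.Injective η := by
    intro i i' h
    have hP : Ideal.span {g i} = Ideal.span {g i'} := by rw [← hηP i, ← hηP i']; congr 1
    by_contra hne
    exact hfg.append_right.not_associated hne (Ideal.span_singleton_eq_span_singleton.mp hP)
  ext q
  rw [Set.mem_setOf_eq, topStratum_eq hZ hF hFZ hb, Set.mem_inter_iff, Set.mem_setOf_eq,
    PrimeSpectrum.mem_zeroLocus, Set.range_subset_iff]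
  set y := X.fromSpecStalk t q with hy
  have hyt : y ⤳ t := fromSpecStalk_specializes q
  have hPy : primeOfSpecializes hyt = q.asIdeal := primeOfSpecializes_fromSpecStalk q
  -- the maximal points outside `F` through `y` are the `ηᵢ` with `gᵢ ∈ q`
  have hset : {η' | η' ∈ {η' | η' ∈ maxPoints Z ∧ η' ∉ F} ∧ η' ⤳ y} =
      η '' {i | g i ∈ q.asIdeal} := by
    ext y'
    simp only [Set.mem_setOf_eq, Set.mem_image]
    constructor
    · rintro ⟨⟨hy'max, hy'F⟩, hy'y⟩
      have hy't : y' ⤳ t := hy'y.trans hyt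
      obtain ⟨i, hi⟩ := exists_primeOfSpecializes_eq_span_g hZ.isClosed hF.isClosed hfg hIZ hIF
        hy'max hy'F hy't
      refine ⟨i, ?_, ?_⟩
      · have hle : primeOfSpecializes hy't ≤ primeOfSpecializes hyt :=
          primeOfSpecializes_le_of_specializes hyt hy't hy'y
        rw [hi, hPy, Ideal.span_singleton_le_iff_mem] at hle
        exact hle
      · have : primeOfSpecializes (hη i) = primeOfSpecializes hy't := by rw [hηP i, hi]
        exact Literature.AlgebraicGeometry.Motives.eq_of_comap_maximalIdeal_eq _ _ this
    · rintro ⟨i, hi, rfl⟩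
      refine ⟨⟨hηmax i, not_mem_of_primeOfSpecializes_eq_span_g hF.isClosed hfg hIF (hη i)
        (hηP i)⟩, ?_⟩
      apply specializes_of_primeOfSpecializes_le hyt (hη i)
      rw [hηP i, hPy, Ideal.span_singleton_le_iff_mem]
      exact hi
  rw [hset, hinj.encard_image]
  constructor
  · rintro ⟨-, hcount⟩ i
    by_contra hi
    -- then the count is at most `m`, contradiction
    have hsub : {i | g i ∈ q.asIdeal} ⊆ (Set.univ \ {i}) := fun j hj =>
      ⟨Set.mem_univ _, fun h => hi (by rw [Set.mem_singleton_iff] at h; exact h ▸ hj)⟩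
    have h1 := (Set.encard_le_encard hsub).trans_eq
      (Set.encard_sdiff_singleton_of_mem (Set.mem_univ i))
    rw [Set.encard_univ, ENat.card_eq_coe_fintype_card, Fintype.card_fin] at h1
    have h2 := hcount.trans h1
    have h3 : ((m + 1 : ℕ) : ℕ∞) - 1 = (m : ℕ∞) := by
      have : ((m + 1 - 1 : ℕ) : ℕ∞) = ((m + 1 : ℕ) : ℕ∞) - ((1 : ℕ) : ℕ∞) := ENat.coe_sub _ _
      rw [Nat.add_sub_cancel, Nat.cast_one] at this
      exact this.symm
    rw [h3] at h2
    have := ENat.coe_le_coe.mp h2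
    omega
  · intro hall
    constructor
    · -- `y ∈ Z`: `I(Z)_t = (∏ f ∏ g) ≤ q` since `g₀ ∈ q`
      apply mem_of_stalkIdeal_vanishingIdeal_le (Z := ⟨Z, hZ.isClosed⟩) hyt
      rw [hPy, hIZ, Ideal.span_singleton_le_iff_mem]
      let i₀ : Fin (m + 1) := 0
      obtain ⟨c, hc⟩ : g i₀ ∣ (∏ j, f j) * ∏ i, g i :=
        (Finset.dvd_prod_of_mem g (Finset.mem_univ i₀)).mul_left _
      rw [hc]
      exact Ideal.mul_mem_right _ _ (hall i₀)
    · have : {i | g i ∈ q.asIdeal} = Set.univ := Set.eq_univ_of_forall hall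
      rw [this, Set.encard_univ, ENat.card_eq_coe_fintype_card, Fintype.card_fin]

include hZ hF hFZ hb hfg hIZ hIF in
/-- **The ideal of the top stratum at one of its points is `(g₁, …, g_{m+1})`**, the ideal of
the coordinate subspace cut out by the unmarked branches (the centre of the next blowing up in
de Jong's recipe is regular, of codimension `m + 1`, in normal crossings position).
[cite: DeJong1996, 2.4, p. 55] -/
theorem stalkIdeal_vanishingIdeal_topStratum (ht : t ∈ topStratum X Z F m) :
    stalkIdeal (vanishingIdeal ⟨topStratum X Z F m, isClosed_topStratum hZ hF hFZ hb⟩) t =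
      Ideal.span (Set.range g) := by
  rw [stalkIdeal_vanishingIdeal_eq_vanishingIdeal_setOf]
  change PrimeSpectrum.vanishingIdeal
    {q : PrimeSpectrum (X.presheaf.stalk t) | X.fromSpecStalk t q ∈ topStratum X Z F m} = _
  rw [setOf_fromSpecStalk_mem_topStratum hZ hF hFZ hb hfg hIZ hIF ht,
    ← PrimeSpectrum.zeroLocus_span, PrimeSpectrum.vanishingIdeal_zeroLocus_eq_radical]
  exact (hfg.append_right.isPrime_span_range).radical

end TopStratumIdeal

end Literature.AlgebraicGeometry.Resolution

end
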